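import Summits.CriticalPhenomena.PercolationContinuityZ3.Theorems.PercNearOneGluingNoHeavyLowerTailUpsetExchangeUnion
import Summits.CriticalPhenomena.PercolationContinuityZ3.Theorems.PercNearOneGluingNoHeavyLowerTailBlockQ9OneDangerousPort
import HarnessLib

/-!
# `NoHeavyLowerTail` (stmt-CriticalPhenomena-4575) — Kozma–Nitzan Question 9 for a glued one-layer block with
# ONE DANGEROUS RELAY attached by ANY number of pairs

Support file (lemma factory `prim-lf-3` gen 6, seat g7; `--supports stmt-CriticalPhenomena-4575`).  No definitions,
no named facts, no sorries.  Memo: `run/shared/lean/prim/prim-lf-3/LF3-Q9LP.md` §3 (Theorem 1).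

`BlockQ9.blockQ9_oneDangerousPort` (prim-hp-1, `…BlockQ9OneDangerousPort.lean`) proves Question 9 / (41) for a glued
one-layer block `O` whose ports all dominate the anchor `a` in the block-deleted graph except ONE port `v`, attached to
`O` by a SINGLE pair, with `a ≤ v` in the unglued ranking graph `w`.  Here the single-pair restriction is removed:

* `real_inter_allClosed_eq` — conditioning a finite set `D` of pairs closed is deleting them up to a nonnegative
  constant: `μ_u(Y ∩ {D closed}) = c · μ_{u_D}(Y)` (iterate `BlockQ9.real_inter_notMem_eq`).
* `blockQ9_oneDangerousRelay` — `O` disjoint from `A`, one-layer (`hiso`), `a, b, v ∉ O`, every port `p ≠ v`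
  dominates `a` in `kill_O w`, `μ_w(a ↔ b) ≤ μ_w(v ↔ b)`; the relay `v` may be joined to `O` by any number of pairs
  (a port shared by several hubs of a depth-two observer) and the weights inside `O` are arbitrary.  Then
  `μ_{glue_O w}(a ↔ b, O ↔ A) ≤ μ_{glue_O w}(O ↔ b)`.
  Proof: split along `E_v = {some pair O–v open}`.  On `E_v`: the UNION up-set exchange
  (`UpsetExchange.upsetExchange_event`, anchored at `v`; `E_v ∩ {O internally open}` is increasing in the open edge
  cluster of `v`).  Off `E_v`: delete the pairs to `v` (`real_inter_allClosed_eq`) and apply Theorem 4 for the block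
  (`BlockQ9.blockThm4_witness`) — every remaining port dominates `a`.  A decision tree over the individual pairs to `v`
  would need `a ≤ v` in `w` MINUS some of those pairs (not implied by the hypothesis); the union event needs only
  `a ≤ v` in `w`.
-/

namespace Summit.CriticalPhenomena.PercolationContinuityZ3.Theorems

open MeasureTheory Set ProbabilityTheory Filter Topology
open Literature.Probability.LatticeModels
open Literature.Probability.Percolation

noncomputable section
open Classical

namespace BlockQ9

variable {n : ℕ}

/-- Conditioning a finite set `D` of pairs CLOSED is deleting them, up to a nonnegative constant:
`μ_u(Y ∩ {D closed}) = c · μ_{u_D}(Y)` for all `Y`, where `u_D` is `u` with the pairs of `D` given weight `0`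
(`c = ∏_{f ∈ D} (1 − u f)`, not needed here). [folklore; Grimmett 1999 §1.3, §2.2] -/
theorem real_inter_allClosed_eq (D : Finset (Sym2 (Fin n))) :
    ∀ u : Sym2 (Fin n) → unitInterval, ∃ c : ℝ, 0 ≤ c ∧ ∀ Y : Set (BondConfig (Fin n)),
      (prodBernoulli u).real (Y ∩ {ω | ∀ f ∈ D, f ∉ ω}) =
        c * (prodBernoulli (fun e => if e ∈ D then 0 else u e)).real Y := by
  classical
  induction D using Finset.induction_on with
  | empty =>
    intro u
    refine ⟨1, zero_le_one, fun Y => ?_⟩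
    have h1 : (Y ∩ {ω : BondConfig (Fin n) | ∀ f ∈ (∅ : Finset (Sym2 (Fin n))), f ∉ ω}) = Y := by
      ext ω; simp
    have h2 : (fun e : Sym2 (Fin n) => if e ∈ (∅ : Finset (Sym2 (Fin n))) then (0 : unitInterval) else u e) = u := by
      funext e; simp
    rw [h1, h2, one_mul]
  | insert f D hfD ih =>
    intro u
    set uf : Sym2 (Fin n) → unitInterval := fun e => if e = f then 0 else u e with huf
    obtain ⟨c', hc', hY'⟩ := ih uf
    refine ⟨(1 - (u f : ℝ)) * c', mul_nonneg (sub_nonneg.2 (u f).2.2) hc', fun Y => ?_⟩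
    have hset : (Y ∩ {ω : BondConfig (Fin n) | ∀ f' ∈ insert f D, f' ∉ ω}) =
        (Y ∩ {ω | ∀ f' ∈ D, f' ∉ ω}) ∩ {ω | f ∉ ω} := by
      ext ω
      simp only [Finset.forall_mem_insert, mem_inter_iff, mem_setOf_eq]
      tauto
    have hw : (fun e : Sym2 (Fin n) => if e ∈ D then (0 : unitInterval) else uf e) =
        fun e => if e ∈ insert f D then 0 else u e := by
      funext e
      by_cases he : e ∈ D
      · simp only [he, if_true, Finset.mem_insert, or_true]
      · by_cases hef : e = f
        · subst hef
          simp [huf, hfD]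
        · simp only [he, if_false, huf, hef, Finset.mem_insert, or_self]
    rw [hset, real_inter_notMem_eq u uf f (by simp only [huf, if_true]) (fun e he => by simp only [huf, if_neg he])
      (Y ∩ {ω | ∀ f' ∈ D, f' ∉ ω}), hY' Y, hw, mul_assoc]

/-- **Question 9 for a glued one-layer block with ONE dangerous relay of ANY multiplicity.**  `O` disjoint from `A`,
one-layer (`hiso`; the weights inside `O` are arbitrary — `w` is the ranking graph); `a, b, v ∉ O`; every port `p ≠ v` dominates `a` in the
block-deleted graph `kill_O w`; and `a` is at most as connected to `b` as `v` in the UNGLUED graph `w`.  The relay `v`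
may be joined to `O` by ANY number of pairs (shared port of several hubs).  Then
`μ_{glue_O w}(a ↔ b, O ↔ A) ≤ μ_{glue_O w}(O ↔ b)`.  (`blockQ9_oneDangerousPort` is the case of a single pair to `v`.)
[cite: KozmaNitzan2024, Thm. 4, Lemma 5, Lemma 3(i), Question 9 (pp. 6, 12–14, 36); VandenbergHaggstromKahn2005, Thm. 1.2] -/
theorem blockQ9_oneDangerousRelay (w : Sym2 (Fin n) → unitInterval) (O A : Finset (Fin n)) (a b v : Fin n)
    (hOA : Disjoint O A) (haO : a ∉ O) (hbO : b ∉ O) (hvO : v ∉ O)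
    (hiso : ∀ x ∈ O, ∀ y : Fin n, y ∉ O → y ∉ A → w s(x, y) = 0)
    (hdom : ∀ p ∈ A, p ≠ v → (∃ o ∈ O, w s(o, p) ≠ 0) →
      (prodBernoulli (fun e : Sym2 (Fin n) => if (∃ x ∈ e, x ∈ O) then 0 else w e)).real (openConn a b) ≤
        (prodBernoulli (fun e : Sym2 (Fin n) => if (∃ x ∈ e, x ∈ O) then 0 else w e)).real (openConn p b))
    (hyp : (prodBernoulli w).real (openConn a b) ≤ (prodBernoulli w).real (openConn v b)) :
    (prodBernoulli (fun e : Sym2 (Fin n) => if (∀ x ∈ e, x ∈ O) ∧ ¬ e.IsDiag then 1 else w e)).real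
        (openConn a b ∩ ⋃ o ∈ O, ⋃ x ∈ A, openConn o x) ≤
      (prodBernoulli (fun e : Sym2 (Fin n) => if (∀ x ∈ e, x ∈ O) ∧ ¬ e.IsDiag then 1 else w e)).real
        (⋃ o ∈ O, openConn o b) := by
  classical
  set g : Sym2 (Fin n) → unitInterval := fun e => if (∀ x ∈ e, x ∈ O) ∧ ¬ e.IsDiag then 1 else w e with hg
  -- the pairs between `O` and `v`, the event that one of them is open, and its complement
  set D : Finset (Sym2 (Fin n)) := O.image (fun o => s(o, v)) with hDdef
  have hmemD : ∀ e, e ∈ D ↔ ∃ o ∈ O, s(o, v) = e := fun e => by rw [hDdef, Finset.mem_image]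
  set Ev : Set (BondConfig (Fin n)) := {ω | ∃ o ∈ O, s(o, v) ∈ ω} with hEv
  set Dcl : Set (BondConfig (Fin n)) := {ω | ∀ f ∈ D, f ∉ ω} with hDcl
  have hDint : ∀ e ∈ D, ¬ ((∀ x ∈ e, x ∈ O) ∧ ¬ e.IsDiag) := by
    intro e he h
    obtain ⟨o, ho, rfl⟩ := (hmemD e).1 he
    exact hvO (h.1 v (Sym2.mem_mk_right o v))
  have hDmeet : ∀ e ∈ D, ∃ x ∈ e, x ∈ O := by
    intro e he
    obtain ⟨o, ho, rfl⟩ := (hmemD e).1 he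
    exact ⟨o, Sym2.mem_mk_left o v, ho⟩
  -- splitting an event along `Ev`
  have hsplit : ∀ X : Set (BondConfig (Fin n)), (prodBernoulli g).real X =
      (prodBernoulli g).real (X ∩ Ev) + (prodBernoulli g).real (X ∩ Dcl) := by
    intro X
    have hX : X ∩ Dcl = X \ Ev := by
      ext ω
      constructor
      · rintro ⟨hXω, hcl⟩
        have hcl' : ∀ f ∈ D, f ∉ ω := hcl
        refine ⟨hXω, ?_⟩
        rintro ⟨o, ho, hov⟩
        exact hcl' _ ((hmemD _).2 ⟨o, ho, rfl⟩) hov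
      · rintro ⟨hXω, hEv'⟩
        have hEv'' : ¬ ∃ o ∈ O, s(o, v) ∈ ω := hEv'
        refine ⟨hXω, ?_⟩
        show ∀ f ∈ D, f ∉ ω
        intro f hf hfω
        obtain ⟨o, ho, rfl⟩ := (hmemD f).1 hf
        exact hEv'' ⟨o, ho, hfω⟩
    rw [hX, measureReal_inter_add_sdiff (MeasurableSet.of_discrete : MeasurableSet Ev) (measure_ne_top _ _)]
  set U : Set (BondConfig (Fin n)) := ⋃ o ∈ O, ⋃ x ∈ A, openConn o x with hU
  -- (i) the part with some pair to `v` open: union up-set exchange anchored at `v`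
  have hopen : (prodBernoulli g).real ((openConn a b ∩ U) ∩ Ev) ≤
      (prodBernoulli g).real ((⋃ o ∈ O, openConn o b) ∩ Ev) := by
    have hE : ∀ ω ω' : BondConfig (Fin n), ω ∈ Ev →
        (∀ e : Sym2 (Fin n), (∀ x ∈ e, x ∈ O) → ¬ e.IsDiag → e ∈ ω) →
        openEdgeCluster ω v ⊆ openEdgeCluster ω' v →
        ω' ∈ Ev ∧ ∀ e : Sym2 (Fin n), (∀ x ∈ e, x ∈ O) → ¬ e.IsDiag → e ∈ ω' := by
      intro ω ω' hω hF hsub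
      obtain ⟨o, ho, hov⟩ := hω
      have hvo : v ≠ o := fun h => hvO (h ▸ ho)
      have hC : ∀ e ∈ ({s(o, v)} : Finset (Sym2 (Fin n))), ¬ e.IsDiag ∧ ∃ x ∈ e, x ∈ O := by
        intro e he
        rw [Finset.mem_singleton] at he
        subst he
        exact ⟨by rw [Sym2.mk_isDiag_iff]; exact fun h => hvo h.symm, o, Sym2.mem_mk_left o v, ho⟩
      have key := UpsetExchange.subset_openEdgeCluster_of_open O {s(o, v)} v o ho
        (Finset.mem_singleton_self _) hvo hC ω hF (by
          intro e he
          rw [Finset.coe_singleton, mem_singleton_iff] at he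
          rw [he]; exact hov)
      refine ⟨⟨o, ho, openEdgeCluster_subset ω' v (hsub (key.2 (by simp)))⟩, fun e heS hed => ?_⟩
      exact openEdgeCluster_subset ω' v (hsub (key.1 e heS hed))
    have hx := UpsetExchange.upsetExchange_event w O a b v Ev hE hyp
    calc (prodBernoulli g).real ((openConn a b ∩ U) ∩ Ev)
        ≤ (prodBernoulli g).real (openConn a b ∩ Ev) :=
          measureReal_mono (fun ω ⟨⟨h1, _⟩, h2⟩ => ⟨h1, h2⟩) (measure_ne_top _ _)
      _ ≤ (prodBernoulli g).real (openConn v b ∩ Ev) := hx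
      _ ≤ (prodBernoulli g).real ((⋃ o ∈ O, openConn o b) ∩ Ev) := by
          refine measureReal_mono (fun ω ⟨h1, h2⟩ => ⟨?_, h2⟩) (measure_ne_top _ _)
          obtain ⟨o, ho, hov⟩ := h2
          have hadj : (openGraph ω).Adj o v := (openGraph_adj ω o v).2 ⟨hov, fun h => hvO (h ▸ ho)⟩
          exact mem_iUnion₂.2 ⟨o, ho, hadj.reachable.trans h1⟩
  -- (ii) the part with every pair to `v` closed: delete those pairs and apply Theorem 4 for the block
  obtain ⟨c, hc, hcY⟩ := real_inter_allClosed_eq D g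
  set w' : Sym2 (Fin n) → unitInterval := fun e => if e ∈ D then 0 else w e with hw'
  have hgD : (fun e : Sym2 (Fin n) => if e ∈ D then (0 : unitInterval) else g e) =
      fun e => if (∀ x ∈ e, x ∈ O) ∧ ¬ e.IsDiag then 1 else w' e := by
    funext e
    by_cases he : e ∈ D
    · simp only [he, if_true, hw', if_neg (hDint e he)]
    · simp only [he, if_false, hg, hw']
  have hkill : (fun e : Sym2 (Fin n) => if (∃ x ∈ e, x ∈ O) then (0 : unitInterval) else w' e) =
      fun e : Sym2 (Fin n) => if (∃ x ∈ e, x ∈ O) then 0 else w e := by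
    funext e
    by_cases he : ∃ x ∈ e, x ∈ O
    · rw [if_pos he, if_pos he]
    · rw [if_neg he, if_neg he]
      have : e ∉ D := fun hD => he (hDmeet e hD)
      simp only [hw', if_neg this]
  have hT4 : (prodBernoulli (fun e : Sym2 (Fin n) => if (∀ x ∈ e, x ∈ O) ∧ ¬ e.IsDiag then 1 else w' e)).real
        (openConn a b ∩ U) ≤
      (prodBernoulli (fun e : Sym2 (Fin n) => if (∀ x ∈ e, x ∈ O) ∧ ¬ e.IsDiag then 1 else w' e)).real
        (⋃ o ∈ O, openConn o b) := by
    refine blockThm4_witness w' O A a b hOA haO hbO (fun x hx y hyO hyA => ?_) (fun p hp hport => ?_)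
    · simp only [hw']
      split_ifs
      · rfl
      · exact hiso x hx y hyO hyA
    · obtain ⟨o, ho, hwo⟩ := hport
      have hne : s(o, p) ∉ D := fun h => by apply hwo; simp only [hw', if_pos h]
      have hwo' : w s(o, p) ≠ 0 := by simpa only [hw', if_neg hne] using hwo
      have hpv : p ≠ v := by
        rintro rfl
        exact hne ((hmemD _).2 ⟨o, ho, rfl⟩)
      rw [hkill]
      exact hdom p hp hpv ⟨o, ho, hwo'⟩
  rw [hsplit (openConn a b ∩ U), hsplit (⋃ o ∈ O, openConn o b), hcY, hcY, hgD]
  nlinarith [mul_le_mul_of_nonneg_left hT4 hc, hopen]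

end BlockQ9

end

end Summit.CriticalPhenomena.PercolationContinuityZ3.Theorems
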